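import Mathlib
import Summits.Ventures.HodgeRepro.T3AdmissibleSign

/-!
# The fourth skew-hermitian line `e₁ e₂ / e₃` is admissible (T3.3, the discriminant half of N1 is free)

Blind re-derivation cell `pub-hodge-repro`, Tier 3, seat `t3-p2` (prover-pub-hodge-repro-t3-p2-g2-0), sub-goal T3.3 of
`route/TIER3.md` (the witness `X` at `n = 3`; §7 «(N1-disc) IS FREE»).  Target tree path
`lean/Summits/Ventures/HodgeRepro/T3FourthLine.lean`.  Imports: Mathlib + this seat's `T3AdmissibleSign` (purely
imaginary elements of a CM field under complex embeddings).

## The statement on paper (`proofs/t3-p2/R3R4-INSTANTIATION.md` §4.4 (N1-disc), merged as TIER3.md §7)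

The seesaw of C7 needs the two hermitian planes `W = W_{i₁} ⊕ W_{i₂}` and `W′ = W_{i₃} ⊕ W_{i₄}` to be isometric; by
Landherr's theorem (Deligne LNM 900 §4 Prop 4.1) this is «equal signatures at every real place» (automatic on every
face, `T3SeesawSigns` / `T3ForcedFourth.even_card_negative_lines`) and «equal discriminants in `F′^×/N(E′^×)`».  The lines
are `W_j = (E′, a_j z w̄)` with `a_j = e_j / δ`, `e_j ∈ E′^{−,×}` a `μ_j`-admissible skew-hermitian element (Liu 2021
Def 4.12, p0020:L44–50: `Im φ(e_j) < 0` for every `φ` in the CM type `Φ_j` of `μ_j`).  Since Liu's Cor 4.20 sums over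
ALL admissible lines, the fourth line may be CHOSEN: `e₄ := e₁ e₂ / e₃`.  Then `e₁ e₂ = e₃ e₄` on the nose (equal
discriminants), and `e₄` is admissible for `Φ₄` because at every embedding `Im φ(e₄) = Im φ(e₁)·Im φ(e₂)/Im φ(e₃)` has
the sign `(−1)^{#neg among e₁, e₂, e₃}`, and the parity identity of the face (an even number of the four lines is negative
at every `φ`) says this is `−1` exactly when `φ ∈ Φ₄`.  This file proves exactly that:

* `conj_neg_mul_div` — `e₁ e₂ / e₃` is again purely imaginary (`complexConj e = −e`);
* `im_map_mul_div` — `Im φ(e₁ e₂ / e₃) = Im φ(e₁) · Im φ(e₂) / Im φ(e₃)` for every complex embedding `φ`;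
* `im_neg_iff_mem_of_cmType` — for a CM type `Φ` (one embedding of each conjugate pair) Liu's one-sided condition
  «`Im φ(e) < 0` for `φ ∈ Φ`» is equivalent to the two-sided «`Im φ(e) < 0 ↔ φ ∈ Φ`»;
* `fourth_line_admissible` — **(N1-disc) is free**: given the parity identity and admissible `e₁, e₂, e₃` for `Φ₁, Φ₂, Φ₃`,
  the element `e₄ := e₁ e₂ / e₃` is a non-zero purely imaginary element, admissible for `Φ₄`, with `e₁ e₂ = e₃ e₄`.

Nothing here says anything about the status of the Hodge conjecture for CM abelian varieties, which is NOT proved.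
-/

set_option autoImplicit false

namespace HodgeRepro.T3.FourthLine

open NumberField
open HodgeRepro.T3.AdmissibleSign (re_map_eq_zero)

variable {L : Type} [Field L] [NumberField L] [NumberField.IsCMField L]

/-- A product of two purely imaginary elements divided by a third is purely imaginary. -/
theorem conj_neg_mul_div {e₁ e₂ e₃ : L} (h₁ : IsCMField.complexConj L e₁ = -e₁)
    (h₂ : IsCMField.complexConj L e₂ = -e₂) (h₃ : IsCMField.complexConj L e₃ = -e₃) :
    IsCMField.complexConj L (e₁ * e₂ / e₃) = -(e₁ * e₂ / e₃) := by
  rw [map_div₀, map_mul, h₁, h₂, h₃, neg_mul_neg, div_neg]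

/-- A non-zero purely imaginary element has non-zero imaginary part under every complex embedding. -/
theorem im_map_ne_zero {e : L} (he : IsCMField.complexConj L e = -e) (he0 : e ≠ 0) (φ : L →+* ℂ) :
    (φ e).im ≠ 0 := by
  intro h0
  apply he0
  apply φ.injective
  rw [map_zero]
  exact Complex.ext (re_map_eq_zero he φ) h0

/-- `Im φ(e₁ e₂ / e₃) = Im φ(e₁) · Im φ(e₂) / Im φ(e₃)` for purely imaginary `e₁, e₂, e₃`. -/
theorem im_map_mul_div {e₁ e₂ e₃ : L} (h₁ : IsCMField.complexConj L e₁ = -e₁)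
    (h₂ : IsCMField.complexConj L e₂ = -e₂) (h₃ : IsCMField.complexConj L e₃ = -e₃) (φ : L →+* ℂ) :
    (φ (e₁ * e₂ / e₃)).im = (φ e₁).im * (φ e₂).im / (φ e₃).im := by
  have r₁ := re_map_eq_zero h₁ φ
  have r₂ := re_map_eq_zero h₂ φ
  have r₃ := re_map_eq_zero h₃ φ
  rw [map_div₀, map_mul, Complex.div_im, Complex.mul_im, Complex.mul_re, r₁, r₂, r₃, Complex.normSq_apply, r₃]
  rcases eq_or_ne (φ e₃).im 0 with h0 | h0
  · rw [h0]
    simp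
  · field_simp
    ring

omit [NumberField L] [NumberField.IsCMField L] in
/-- For a CM type `Φ` of embeddings (exactly one of each conjugate pair) and a purely imaginary `e`, Liu's
one-sided admissibility «`Im φ(e) < 0` for all `φ ∈ Φ`» is the two-sided «`Im φ(e) < 0 ↔ φ ∈ Φ`». -/
theorem im_neg_iff_mem_of_cmType {Φ : Finset (L →+* ℂ)}
    (hΦ : ∀ φ : L →+* ℂ, φ ∈ Φ ↔ ComplexEmbedding.conjugate φ ∉ Φ) {e : L}
    (hneg : ∀ φ ∈ Φ, (φ e).im < 0) (φ : L →+* ℂ) : (φ e).im < 0 ↔ φ ∈ Φ := by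
  refine ⟨fun h => ?_, hneg φ⟩
  by_contra hφ
  have hc : ComplexEmbedding.conjugate φ ∈ Φ := by
    by_contra hc
    exact hφ ((hΦ φ).2 hc)
  have := hneg _ hc
  rw [ComplexEmbedding.conjugate_coe_eq, Complex.conj_im] at this
  linarith

/-- The sign of `y₁ y₂ / y₃` for non-zero reals: negative iff an odd number of the `y_j` is negative. -/
theorem mul_div_neg_iff_odd {y₁ y₂ y₃ : ℝ} (h₁ : y₁ ≠ 0) (h₂ : y₂ ≠ 0) (h₃ : y₃ ≠ 0) :
    y₁ * y₂ / y₃ < 0 ↔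
      Odd ((if y₁ < 0 then 1 else 0) + (if y₂ < 0 then 1 else 0) + (if y₃ < 0 then 1 else 0) : ℕ) := by
  rcases lt_or_gt_of_ne h₁ with a | a <;> rcases lt_or_gt_of_ne h₂ with b | b <;>
    rcases lt_or_gt_of_ne h₃ with c | c <;>
    simp [a, b, c, not_lt.2 a.le, not_lt.2 b.le, not_lt.2 c.le, div_neg_iff, mul_neg_iff, mul_pos_iff,
      Nat.odd_iff]

/-- **The fourth line is admissible.**  Let `Φ₁, Φ₂, Φ₃, Φ₄` be finite sets of complex embeddings of the CM field `L`
such that at every embedding `φ` an EVEN number of them contains `φ` (the parity identity of a face,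
`T3ForcedFourth.even_card_negative_lines`), and let `e₁, e₂, e₃ ∈ L` be non-zero purely imaginary elements admissible
for `Φ₁, Φ₂, Φ₃` (`Im φ(e_j) < 0 ↔ φ ∈ Φ_j`).  Then `e₄ := e₁ e₂ / e₃` is non-zero, purely imaginary, admissible for
`Φ₄`, and `e₁ e₂ = e₃ e₄` — the discriminant half of N1 holds with the discriminants EQUAL, not merely equal modulo
norms (`proofs/t3-p2/R3R4-INSTANTIATION.md` §4.4 (N1-disc)). -/
theorem fourth_line_admissible [DecidableEq (L →+* ℂ)] (Φ₁ Φ₂ Φ₃ Φ₄ : Finset (L →+* ℂ))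
    (hpar : ∀ φ : L →+* ℂ, Even ((if φ ∈ Φ₁ then 1 else 0) + (if φ ∈ Φ₂ then 1 else 0)
      + (if φ ∈ Φ₃ then 1 else 0) + (if φ ∈ Φ₄ then 1 else 0) : ℕ))
    {e₁ e₂ e₃ : L}
    (h₁ : IsCMField.complexConj L e₁ = -e₁) (h₁0 : e₁ ≠ 0) (hΦ₁ : ∀ φ : L →+* ℂ, (φ e₁).im < 0 ↔ φ ∈ Φ₁)
    (h₂ : IsCMField.complexConj L e₂ = -e₂) (h₂0 : e₂ ≠ 0) (hΦ₂ : ∀ φ : L →+* ℂ, (φ e₂).im < 0 ↔ φ ∈ Φ₂)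
    (h₃ : IsCMField.complexConj L e₃ = -e₃) (h₃0 : e₃ ≠ 0) (hΦ₃ : ∀ φ : L →+* ℂ, (φ e₃).im < 0 ↔ φ ∈ Φ₃) :
    IsCMField.complexConj L (e₁ * e₂ / e₃) = -(e₁ * e₂ / e₃) ∧ e₁ * e₂ / e₃ ≠ 0
      ∧ (∀ φ : L →+* ℂ, (φ (e₁ * e₂ / e₃)).im < 0 ↔ φ ∈ Φ₄) ∧ e₁ * e₂ = e₃ * (e₁ * e₂ / e₃) := by
  refine ⟨conj_neg_mul_div h₁ h₂ h₃, div_ne_zero (mul_ne_zero h₁0 h₂0) h₃0, ?_, (mul_div_cancel₀ _ h₃0).symm⟩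
  intro φ
  have y₁ := im_map_ne_zero h₁ h₁0 φ
  have y₂ := im_map_ne_zero h₂ h₂0 φ
  have y₃ := im_map_ne_zero h₃ h₃0 φ
  rw [im_map_mul_div h₁ h₂ h₃ φ, mul_div_neg_iff_odd y₁ y₂ y₃]
  have hp := hpar φ
  rw [Nat.even_iff] at hp
  rw [Nat.odd_iff]
  by_cases m1 : φ ∈ Φ₁ <;> by_cases m2 : φ ∈ Φ₂ <;> by_cases m3 : φ ∈ Φ₃ <;> by_cases m4 : φ ∈ Φ₄ <;>
    simp [m1, m2, m3, m4, hΦ₁ φ, hΦ₂ φ, hΦ₃ φ] at hp ⊢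

end HodgeRepro.T3.FourthLine
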